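import Literature.Probability.LatticeModels.DobrushinFiniteRangePotential
import Literature.Probability.LatticeModels.DobrushinComparisonDefectStates
import HarnessLib

/-!
# Continuity of the Gibbs state in the interaction inside Dobrushin's regime, LOCALISED form:
# perturbing a finite-range potential near a set of sites moves the expectations of an observable by
# an amount that decays geometrically in the distance from the perturbation to the observable
# (Föllmer's Comparison Theorem (2.8)/(2.10) with defects; Georgii Thm. 8.20 / Cor. 8.23; Gross 1981)

[topic Probability/LatticeModels]

`DobrushinComparisonDefectStates.lean` proves Föllmer's Comparison Theorem (2.8) at the measure
level: a Gibbs measure `μ` of a specification `γ` under Dobrushin's condition (Vasserstein form,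
`IsKRContraction γ r nbr C`, rows `≤ c < 1`) is compared with ANY probability measure `ν` whose
defect against the one-site averaging of `γ` is a vector `b`, through any super-solution `d` of
`b + C d ≤ d`.  This file specialises it twice:

* `DobrushinMetric.abs_integral_sub_integral_le_of_gibbs_pair_local` — `ν` a Gibbs measure of a
  SECOND specification `γ'` whose one-site laws at `x` are `b x`-close to those of `γ`, uniformly
  in the boundary condition, in the distance dual to `r` (SITE-DEPENDENT defect; by the DLR
  equations of `ν` for `γ'_x` the defect of `ν` against `γ_x` is `≤ b x · δ_x(f)`) — Föllmer 1988,
  Ch. I, (2.8) with (2.10): `|μ f − μ̃ f| ≤ ∑_y (δ(f) D)_y b_y`, `D = ∑ₙ Cⁿ`, here through a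
  super-solution `d ≥ D b`; Georgii 2011, Thm. 8.20.
* `DobrushinMetric.superSolution_geometric` — bookkeeping: if `b ≤ B` is supported where a profile
  `ℓ` vanishes and `ℓ` grows by at most `1` along `nbr`, then `d x = B (1 − c)⁻¹ c^{ℓ x}` is a
  super-solution (the geometric majorant of `D b` for a localised defect).
* `abs_hamiltonianTsum_singleton_sub_of_perturbation` — two adapted potentials with
  `|Φ_B − Φ'_B| ≤ e B` have interactions through `x` differing by at most `E x = ∑_{B ∋ x} e B`.
* `abs_integral_sub_integral_le_of_potential_perturbation` — for the Gibbsian specifications of two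
  such potentials at inverse temperature `β`, the first of finite range `nbr` with Simon rows
  `∑_{y ∈ nbr x} |β| D x y ≤ c < 1` (`isKRContraction_gibbsSpecOfSummablePotential`), ANY Gibbs
  measures `μ` of `Φ` and `μ'` of `Φ'`, and any super-solution `d` of `½|β| E + C d ≤ d`:
  `|∫ f dμ − ∫ f dμ'| ≤ ∑_{y ∈ Δ_f} d y · δ_y(f)` (one-site defect `½ |β| E x` by Simon's lemma
  `DobrushinMetric.abs_integral_tilted_sub_integral_tilted_le_linear'`).
* `abs_integral_sub_integral_le_of_potential_perturbation_geometric` — the LOCALISED form: if the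
  perturbation lives where `ℓ = 0` (`E x = 0` whenever `ℓ x ≠ 0`, `E ≤ E₀`), then
  `|∫ f dμ − ∫ f dμ'| ≤ ½|β| E₀ (1 − c)⁻¹ ∑_{y ∈ Δ_f} c^{ℓ y} δ_y(f)` — the response of the Gibbs state
  to a local change of the interaction decays geometrically in the `nbr`-distance from the change
  (Gross 1981 / Künsch 1982 in Föllmer's formulation, Ch. I, (2.10) with (2.23)).

Scope (honest label): finite-range first potential (the second one is arbitrary with a summable
majorant); discrete weight `r ≡ 1` (total variation); `V` countable, any measurable spin space with
an a priori probability measure; no uniqueness is assumed — the estimate holds for every pair of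
Gibbs measures of the two specifications (for the first one there is at most one, by the companion
files).

## References
* H. Föllmer, *Random fields and diffusion processes*, LNM 1362 (1988), Ch. I, (2.2)–(2.3),
  Comparison Theorem (2.8), (2.10), Remark (2.17), (2.23).
* H.-O. Georgii, *Gibbs Measures and Phase Transitions*, 2nd ed. (2011), Thm. 8.20, Cor. 8.23.
* L. Gross, *Absence of second-order phase transitions in the Dobrushin uniqueness region*,
  J. Stat. Phys. 25 (1981) 57–72 (smooth dependence of the state on local parameters).
* B. Simon, Commun. Math. Phys. 68 (1979) 183–185, Lemma p. 184.
-/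

noncomputable section

open MeasureTheory Finset Function

namespace Literature.Probability.LatticeModels

variable {V S : Type*} [DecidableEq V] [MeasurableSpace S]

namespace DobrushinMetric

/-! ### Two specifications with close one-site laws: site-dependent defect -/

/-- **Comparison of the Gibbs states of two specifications, site-dependent defect** (Föllmer 1988,
Ch. I, Comparison Theorem (2.8) with (2.10); Georgii 2011, Thm. 8.20): let `γ` satisfy Dobrushin's
condition in the Vasserstein form with rows `≤ c < 1`, `μ` be a Gibbs measure of `γ`, and `ν` a Gibbs
measure of another specification `γ'` whose one-site law at `x` is `b x`-close to that of `γ`,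
uniformly in the boundary condition, in the distance dual to `r`; then for every super-solution
`d ≥ 0` of `b x + ∑_{y ∈ nbr x} C x y d y ≤ d x` and every bounded measurable `f` depending on `Δ`
with Lipschitz vector `δ`: `|∫ f dμ − ∫ f dν| ≤ ∑_{y ∈ Δ} d y δ y`.  (The DLR equations of `ν` for
`γ'_x` turn the kernel closeness into the functional defect of
`abs_integral_sub_integral_le_of_defect`.) [cite: Follmer1988, Ch. I Comparison Theorem (2.8), (2.10)] -/
theorem abs_integral_sub_integral_le_of_gibbs_pair_local {γ γ' : Specification V S}
    (hγ : IsSpecification γ) (hγ' : IsSpecification γ') {r : S → S → ℝ} {nbr : V → Finset V}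
    {C : V → V → ℝ} (hC : IsKRContraction γ r nbr C) {R : ℝ} (hr0 : ∀ a b, 0 ≤ r a b)
    (hrR : ∀ a b, r a b ≤ R) (hR : 0 ≤ R) {c : ℝ} (hc0 : 0 ≤ c) (hc1 : c < 1)
    (hrow : ∀ x, ∑ y ∈ nbr x, C x y ≤ c) {μ : Measure (V → S)} (hμ : IsGibbsMeasure γ μ)
    {ν : Measure (V → S)} (hν : IsGibbsMeasure γ' ν) {b : V → ℝ} (hb : ∀ x, 0 ≤ b x)
    (hker : ∀ (x : V) (η : V → S) (φ : S → ℝ) (L : ℝ), Measurable φ → (∃ M, ∀ s, |φ s| ≤ M) →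
      0 ≤ L → (∀ a a', |φ a - φ a'| ≤ L * r a a') →
      |(∫ s, φ s ∂(siteLaw γ x η)) - ∫ s, φ s ∂(siteLaw γ' x η)| ≤ b x * L)
    {d : V → ℝ} (hd0 : ∀ y, 0 ≤ d y) (hd : ∀ x, b x + (∑ y ∈ nbr x, C x y * d y) ≤ d x)
    {f : (V → S) → ℝ} (hfm : Measurable f) {Δ : Finset V} (hfdep : DependsOn f (↑Δ : Set V))
    {M : ℝ} (hM : ∀ σ, |f σ| ≤ M) {δ : V → ℝ} (hδ : IsLipBound r f δ) :
    |(∫ σ, f σ ∂μ) - ∫ σ, f σ ∂ν| ≤ ∑ y ∈ Δ, d y * δ y := by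
  haveI := hν.isProbabilityMeasure
  -- the defect of `ν` against the one-site averaging of `γ`
  have hdef : ∀ (x : V) (g : (V → S) → ℝ) (Δ' : Finset V) (δ' : V → ℝ), Measurable g →
      DependsOn g (↑Δ' : Set V) → (∃ M, ∀ σ, |g σ| ≤ M) → IsLipBound r g δ' →
        |(∫ σ, siteAvg γ x g σ ∂ν) - ∫ σ, g σ ∂ν| ≤ b x * δ' x := by
    intro x g Δ' δ' hgm _ hgb hgδ
    obtain ⟨Mg, hMg⟩ := hgb
    have hDLR : ∫ σ, siteAvg γ' x g σ ∂ν = ∫ σ, g σ ∂ν :=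
      hν.integral_integral_eq hγ' {x} (integrable_of_abs_le' hgm hMg)
    have hi₁ : Integrable (siteAvg γ x g) ν :=
      integrable_of_abs_le' (measurable_siteAvg hγ x hgm) (abs_siteAvg_le hγ x hMg)
    have hi₂ : Integrable (siteAvg γ' x g) ν :=
      integrable_of_abs_le' (measurable_siteAvg hγ' x hgm) (abs_siteAvg_le hγ' x hMg)
    rw [← hDLR, ← integral_sub hi₁ hi₂]
    have hpt : ∀ σ, |siteAvg γ x g σ - siteAvg γ' x g σ| ≤ b x * δ' x := by
      intro σ
      rw [siteAvg_eq_integral_siteLaw hγ x hgm σ, siteAvg_eq_integral_siteLaw hγ' x hgm σ]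
      refine hker x σ (fun s => g (Function.update σ x s)) (δ' x) (hgm.comp (measurable_update σ))
        ⟨Mg, fun s => hMg _⟩ (hgδ.nonneg x) fun a a' => ?_
      have h := hgδ.le x (Function.update σ x a) (Function.update σ x a')
        (fun z hz => by rw [Function.update_of_ne hz, Function.update_of_ne hz])
      simpa using h
    calc |∫ σ, (siteAvg γ x g σ - siteAvg γ' x g σ) ∂ν|
        ≤ ∫ σ, |siteAvg γ x g σ - siteAvg γ' x g σ| ∂ν := abs_integral_le_integral_abs
      _ ≤ ∫ _σ, b x * δ' x ∂ν :=
          integral_mono (hi₁.sub hi₂).abs (integrable_const _) hpt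
      _ = b x * δ' x := by simp
  exact abs_integral_sub_integral_le_of_defect hγ hC hr0 hrR hR hc0 hc1 hrow hμ (ν := ν) hb hdef
    hd0 hd hfm hfdep hM hδ

/-! ### The geometric super-solution for a localised defect -/

omit [DecidableEq V] [MeasurableSpace S] in
/-- **Geometric super-solution** (Föllmer 1988, Ch. I, (2.10) with the profile of (2.23): for a
defect supported where `ℓ = 0`, the rows of `D = ∑ₙ Cⁿ` decay like `c^{ℓ}`): if `0 ≤ b ≤ B`,
`b x = 0` wherever `ℓ x ≠ 0`, the rows of `C ≥ 0` over `nbr x` are `≤ c < 1`, and `ℓ x ≤ ℓ y + 1` for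
`y ∈ nbr x`, then `d x = B (1 − c)⁻¹ c^{ℓ x}` satisfies `b x + ∑_{y ∈ nbr x} C x y d y ≤ d x`.
[cite: Follmer1988, Ch. I (2.10)] -/
theorem superSolution_geometric {nbr : V → Finset V} {C : V → V → ℝ} (hC0 : ∀ x y, 0 ≤ C x y)
    {c : ℝ} (hc0 : 0 ≤ c) (hc1 : c < 1) (hrow : ∀ x, ∑ y ∈ nbr x, C x y ≤ c)
    {b : V → ℝ} {B : ℝ} (hb0 : ∀ x, 0 ≤ b x) (hbB : ∀ x, b x ≤ B) (ℓ : V → ℕ)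
    (hbℓ : ∀ x, ℓ x ≠ 0 → b x = 0) (hℓ : ∀ x, ∀ y ∈ nbr x, ℓ x ≤ ℓ y + 1) (x : V) :
    b x + (∑ y ∈ nbr x, C x y * (B / (1 - c) * c ^ ℓ y)) ≤ B / (1 - c) * c ^ ℓ x := by
  have h1c : 0 < 1 - c := sub_pos.2 hc1
  have hB : 0 ≤ B := (hb0 x).trans (hbB x)
  have hK : 0 ≤ B / (1 - c) := div_nonneg hB h1c.le
  have hc1' : c ≤ 1 := hc1.le
  rcases Nat.eq_zero_or_pos (ℓ x) with hℓx | hℓx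
  · -- at the perturbation: `b x + K ∑ C c^{ℓ y} ≤ B + K c = K`
    rw [hℓx, pow_zero, mul_one]
    have hsum : ∑ y ∈ nbr x, C x y * (B / (1 - c) * c ^ ℓ y) ≤ B / (1 - c) * c := by
      calc ∑ y ∈ nbr x, C x y * (B / (1 - c) * c ^ ℓ y)
          ≤ ∑ y ∈ nbr x, C x y * (B / (1 - c)) :=
            Finset.sum_le_sum fun y _ => mul_le_mul_of_nonneg_left
              (mul_le_of_le_one_right hK (pow_le_one₀ hc0 hc1')) (hC0 x y)
        _ = (∑ y ∈ nbr x, C x y) * (B / (1 - c)) := by rw [Finset.sum_mul]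
        _ ≤ c * (B / (1 - c)) := mul_le_mul_of_nonneg_right (hrow x) hK
        _ = B / (1 - c) * c := mul_comm _ _
    have hfix : B + B / (1 - c) * c = B / (1 - c) := by
      field_simp
      ring
    linarith [hbB x]
  · -- away from it: `b x = 0` and `∑ C c^{ℓ y} ≤ c^{ℓ x - 1} ∑ C ≤ c^{ℓ x}`
    have hbx : b x = 0 := hbℓ x (Nat.pos_iff_ne_zero.1 hℓx)
    rw [hbx, zero_add]
    obtain ⟨n, hn⟩ : ∃ n, ℓ x = n + 1 := ⟨ℓ x - 1, by omega⟩
    have hpow : ∀ y ∈ nbr x, c ^ ℓ y ≤ c ^ n := fun y hy =>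
      pow_le_pow_of_le_one hc0 hc1' (by have := hℓ x y hy; omega)
    calc ∑ y ∈ nbr x, C x y * (B / (1 - c) * c ^ ℓ y)
        ≤ ∑ y ∈ nbr x, C x y * (B / (1 - c) * c ^ n) :=
          Finset.sum_le_sum fun y hy => mul_le_mul_of_nonneg_left
            (mul_le_mul_of_nonneg_left (hpow y hy) hK) (hC0 x y)
      _ = (∑ y ∈ nbr x, C x y) * (B / (1 - c) * c ^ n) := by rw [Finset.sum_mul]
      _ ≤ c * (B / (1 - c) * c ^ n) := mul_le_mul_of_nonneg_right (hrow x) (by positivity)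
      _ = B / (1 - c) * c ^ ℓ x := by rw [hn, pow_succ]; ring

end DobrushinMetric

/-! ### Two potentials: the one-site defect from Simon's lemma -/

section Potentials

variable {Φ Φ' : Potential V S} {b b' e : Finset V → ℝ} {nbr : V → Finset V}

omit [MeasurableSpace S] in
/-- **Interactions through a site of two close potentials** : if `|Φ_B − Φ'_B| ≤ e B` for all `B`
and the family `e` is summable through `x`, then `|H_{x}(σ) − H'_{x}(σ)| ≤ E x = ∑_{B ∋ x} e B`
(Georgii 2011, (2.11); Föllmer 1988, Ch. I, (2.2): the one-site defect is measured kernel by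
kernel). [cite: Georgii2011, eq. (2.11)] -/
theorem abs_hamiltonianTsum_singleton_sub_of_perturbation (hb : Φ.HasSummableBound b)
    (hb' : Φ'.HasSummableBound b') (he : ∀ B σ, |Φ B σ - Φ' B σ| ≤ e B) (x : V) {E : ℝ}
    (hE : HasSum (fun B : Finset V => if x ∈ B then e B else 0) E) (σ : V → S) :
    |hamiltonianTsum Φ {x} σ - hamiltonianTsum Φ' {x} σ| ≤ E := by
  have hS := summable_hamiltonianTsum hb {x} σ
  have hS' := summable_hamiltonianTsum hb' {x} σ
  unfold hamiltonianTsum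
  rw [← hS.tsum_sub hS', ← hE.tsum_eq]
  have hxB : ∀ B : Finset V, (B ∩ {x}).Nonempty ↔ x ∈ B := fun B => by simp [Finset.Nonempty]
  have hterm : ∀ B : Finset V,
      ‖(if (B ∩ {x}).Nonempty then Φ B σ else 0) - (if (B ∩ {x}).Nonempty then Φ' B σ else 0)‖ ≤
        (if x ∈ B then e B else 0) := by
    intro B
    rw [Real.norm_eq_abs]
    by_cases hx : x ∈ B
    · rw [if_pos ((hxB B).2 hx), if_pos ((hxB B).2 hx), if_pos hx]
      exact he B σ
    · rw [if_neg (fun h => hx ((hxB B).1 h)), if_neg (fun h => hx ((hxB B).1 h)), if_neg hx,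
        sub_zero, abs_zero]
  calc |∑' B : Finset V, ((if (B ∩ {x}).Nonempty then Φ B σ else 0) -
          (if (B ∩ {x}).Nonempty then Φ' B σ else 0))|
      = ‖∑' B : Finset V, ((if (B ∩ {x}).Nonempty then Φ B σ else 0) -
          (if (B ∩ {x}).Nonempty then Φ' B σ else 0))‖ := (Real.norm_eq_abs _).symm
    _ ≤ ∑' B : Finset V, ‖(if (B ∩ {x}).Nonempty then Φ B σ else 0) -
          (if (B ∩ {x}).Nonempty then Φ' B σ else 0)‖ :=
        norm_tsum_le_tsum_norm (Summable.of_norm_bounded hE.summable hterm).norm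
    _ ≤ ∑' B : Finset V, (if x ∈ B then e B else 0) :=
        Summable.tsum_le_tsum hterm (Summable.of_norm_bounded hE.summable hterm).norm hE.summable

/-- **One-site laws of two close potentials** (Simon 1979, Lemma p. 184: `‖μ_h − μ_g‖ ≤ ‖h − g‖_∞`;
Georgii 2011, Thm. 8.20, the hypothesis `sup_η ‖γ_x(·|η) − γ'_x(·|η)‖`): the one-site laws at `x` of
the Gibbsian specifications of `Φ` and `Φ'` at inverse temperature `β` are `½ |β| E x`-close in the
total-variation (oscillation-dual) sense, uniformly in the boundary condition.
[cite: Simon1979Dobrushin, Lemma] -/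
theorem abs_integral_siteLaw_sub_siteLaw_le_of_perturbation [Countable V] (ν : Measure S)
    [IsProbabilityMeasure ν] (hΦ : Φ.IsAdapted) (hb : Φ.HasSummableBound b) (hΦ' : Φ'.IsAdapted)
    (hb' : Φ'.HasSummableBound b') (he : ∀ B σ, |Φ B σ - Φ' B σ| ≤ e B) (β : ℝ) (x : V) {E : ℝ}
    (hE : HasSum (fun B : Finset V => if x ∈ B then e B else 0) E) (η : V → S) {φ : S → ℝ}
    {L : ℝ} (hφm : Measurable φ) (hφb : ∃ M, ∀ s, |φ s| ≤ M) (hφ : ∀ a c, |φ a - φ c| ≤ L) :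
    |(∫ s, φ s ∂(DobrushinMetric.siteLaw (gibbsSpecOfSummablePotential ν Φ β) x η)) -
        ∫ s, φ s ∂(DobrushinMetric.siteLaw (gibbsSpecOfSummablePotential ν Φ' β) x η)| ≤
      |β| * E / 2 * L := by
  rw [siteLaw_gibbsSpecOfSummablePotential ν hΦ hb β x η,
    siteLaw_gibbsSpecOfSummablePotential ν hΦ' hb' β x η]
  have hm : ∀ {Ψ : Potential V S} {bΨ : Finset V → ℝ}, Ψ.IsAdapted → Ψ.HasSummableBound bΨ →
      Measurable fun s : S => -β * hamiltonianTsum Ψ {x} (Function.update η x s) :=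
    fun hΨ hbΨ => ((measurable_hamiltonianTsum (fun B => (hΨ B).2) hbΨ {x}).comp
      (measurable_update η)).const_mul _
  have hbd : ∀ {Ψ : Potential V S} {bΨ : Finset V → ℝ}, Ψ.HasSummableBound bΨ →
      ∃ B, ∀ s : S, |-β * hamiltonianTsum Ψ {x} (Function.update η x s)| ≤ B := by
    intro Ψ bΨ hbΨ
    refine ⟨|β| * ∑' B : Finset V, (if (B ∩ {x}).Nonempty then bΨ B else 0), fun s => ?_⟩
    rw [abs_mul, abs_neg]
    exact mul_le_mul_of_nonneg_left (abs_hamiltonianTsum_le hbΨ {x} _) (abs_nonneg β)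
  have key := DobrushinMetric.abs_integral_tilted_sub_integral_tilted_le_linear' ν (hm hΦ hb)
    (hm hΦ' hb') (hbd hb) (hbd hb') (ε := |β| * E) (fun s => ?_) hφm hφb hφ
  · simpa [div_mul_eq_mul_div, mul_div_assoc] using key
  · rw [← mul_sub, abs_mul, abs_neg]
    exact mul_le_mul_of_nonneg_left
      (abs_hamiltonianTsum_singleton_sub_of_perturbation hb hb' he x hE _) (abs_nonneg β)

/-- **Continuity of the Gibbs state in the interaction, Dobrushin regime** (Georgii 2011, Thm. 8.20
with Cor. 8.23; Föllmer 1988, Ch. I, (2.8)/(2.10)): let `Φ` be an adapted potential with majorant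
`b` of finite range `nbr` whose Simon rows satisfy `∑_{y ∈ nbr x} |β| D x y ≤ c < 1`, and `Φ'` any
adapted potential with a summable majorant and `|Φ_B − Φ'_B| ≤ e B`, `E x = ∑_{B ∋ x} e B`.  Then for
ANY Gibbs measures `μ` of `Φ` and `μ'` of `Φ'` (at the same `β`, a priori measure `ν`), any
super-solution `d ≥ 0` of `½|β| E x + ∑_{y ∈ nbr x} |β| D x y · d y ≤ d x`, and every bounded
measurable `f` depending on `Δ` with oscillation vector `δ`:
`|∫ f dμ − ∫ f dμ'| ≤ ∑_{y ∈ Δ} d y δ y`. [cite: Follmer1988, Ch. I Comparison Theorem (2.8), (2.10)] -/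
theorem abs_integral_sub_integral_le_of_potential_perturbation [Countable V]
    [MeasurableSingletonClass S] (ν : Measure S) [IsProbabilityMeasure ν] (hΦ : Φ.IsAdapted)
    (hb : Φ.HasSummableBound b) (hΦ' : Φ'.IsAdapted) (hb' : Φ'.HasSummableBound b')
    (he : ∀ B σ, |Φ B σ - Φ' B σ| ≤ e B) (β : ℝ) {E : V → ℝ}
    (hE : ∀ x, HasSum (fun B : Finset V => if x ∈ B then e B else 0) (E x))
    (hnot : ∀ x, x ∉ nbr x)
    (hrange : ∀ B : Finset V, b B ≠ 0 → ∀ x ∈ B, ∀ z ∈ B, z ≠ x → z ∈ nbr x)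
    {c : ℝ} (hc0 : 0 ≤ c) (hc1 : c < 1)
    (hrow : ∀ x, ∑ y ∈ nbr x, |β| * (∑' B : Finset V, if x ∈ B ∧ y ∈ B then b B else 0) ≤ c)
    {μ : Measure (V → S)} (hμ : IsGibbsMeasure (gibbsSpecOfSummablePotential ν Φ β) μ)
    {μ' : Measure (V → S)} (hμ' : IsGibbsMeasure (gibbsSpecOfSummablePotential ν Φ' β) μ')
    {d : V → ℝ} (hd0 : ∀ y, 0 ≤ d y)
    (hd : ∀ x, |β| * E x / 2 +
      (∑ y ∈ nbr x, |β| * (∑' B : Finset V, if x ∈ B ∧ y ∈ B then b B else 0) * d y) ≤ d x)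
    {f : (V → S) → ℝ} (hfm : Measurable f) {Δ : Finset V} (hfdep : DependsOn f (↑Δ : Set V))
    {M : ℝ} (hM : ∀ σ, |f σ| ≤ M) {δ : V → ℝ}
    (hδ : DobrushinMetric.IsLipBound (fun _ _ => (1 : ℝ)) f δ) :
    |(∫ σ, f σ ∂μ) - ∫ σ, f σ ∂μ'| ≤ ∑ y ∈ Δ, d y * δ y := by
  have hE0 : ∀ x, 0 ≤ E x := fun x => (hE x).nonneg fun B => by
    split_ifs
    · obtain ⟨s₀, -⟩ : (Set.univ : Set S).Nonempty :=
        nonempty_of_measure_ne_zero (μ := ν) (by rw [measure_univ]; exact one_ne_zero)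
      exact (abs_nonneg _).trans (he B fun _ => s₀)
    · exact le_rfl
  refine DobrushinMetric.abs_integral_sub_integral_le_of_gibbs_pair_local
    (isSpecification_gibbsSpecOfSummablePotential ν hΦ hb β)
    (isSpecification_gibbsSpecOfSummablePotential ν hΦ' hb' β)
    (isKRContraction_gibbsSpecOfSummablePotential ν hΦ hb β hnot hrange) (R := 1)
    (fun _ _ => zero_le_one) (fun _ _ => le_rfl) zero_le_one hc0 hc1 hrow hμ hμ'
    (b := fun x => |β| * E x / 2) (fun x => by have := hE0 x; positivity)
    (fun x η φ L hφm hφb _hL hφL => ?_) hd0 hd hfm hfdep hM hδ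
  calc |(∫ s, φ s ∂(DobrushinMetric.siteLaw (gibbsSpecOfSummablePotential ν Φ β) x η)) -
        ∫ s, φ s ∂(DobrushinMetric.siteLaw (gibbsSpecOfSummablePotential ν Φ' β) x η)|
      ≤ |β| * E x / 2 * L :=
        abs_integral_siteLaw_sub_siteLaw_le_of_perturbation ν hΦ hb hΦ' hb' he β x (hE x) η hφm
          hφb fun a a' => by simpa using hφL a a'
    _ = (fun x => |β| * E x / 2) x * L := rfl

/-- **Localised perturbation ⇒ geometrically decaying response** (Föllmer 1988, Ch. I, (2.10)
with (2.23); Gross 1981; Georgii 2011, Cor. 8.23): in the setting of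
`abs_integral_sub_integral_le_of_potential_perturbation`, if the perturbation is confined to the
sites where a profile `ℓ` vanishes (`E x = 0` whenever `ℓ x ≠ 0`, `E ≤ E₀`) and `ℓ` grows by at most
`1` along `nbr`, then for ANY Gibbs measures `μ` of `Φ` and `μ'` of `Φ'`:
`|∫ f dμ − ∫ f dμ'| ≤ ½ |β| E₀ (1 − c)⁻¹ ∑_{y ∈ Δ} c^{ℓ y} δ_y(f)` — exponentially small in the
`nbr`-distance from the perturbation to the support of `f`.
[cite: Follmer1988, Ch. I (2.10)] -/
theorem abs_integral_sub_integral_le_of_potential_perturbation_geometric [Countable V]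
    [MeasurableSingletonClass S] (ν : Measure S) [IsProbabilityMeasure ν] (hΦ : Φ.IsAdapted)
    (hb : Φ.HasSummableBound b) (hΦ' : Φ'.IsAdapted) (hb' : Φ'.HasSummableBound b')
    (he : ∀ B σ, |Φ B σ - Φ' B σ| ≤ e B) (β : ℝ) {E : V → ℝ}
    (hE : ∀ x, HasSum (fun B : Finset V => if x ∈ B then e B else 0) (E x)) {E₀ : ℝ}
    (hE₀ : 0 ≤ E₀) (hEE : ∀ x, E x ≤ E₀) (ℓ : V → ℕ) (hEℓ : ∀ x, ℓ x ≠ 0 → E x = 0)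
    (hnot : ∀ x, x ∉ nbr x)
    (hrange : ∀ B : Finset V, b B ≠ 0 → ∀ x ∈ B, ∀ z ∈ B, z ≠ x → z ∈ nbr x)
    (hℓ : ∀ x, ∀ y ∈ nbr x, ℓ x ≤ ℓ y + 1) {c : ℝ} (hc0 : 0 ≤ c) (hc1 : c < 1)
    (hrow : ∀ x, ∑ y ∈ nbr x, |β| * (∑' B : Finset V, if x ∈ B ∧ y ∈ B then b B else 0) ≤ c)
    {μ : Measure (V → S)} (hμ : IsGibbsMeasure (gibbsSpecOfSummablePotential ν Φ β) μ)
    {μ' : Measure (V → S)} (hμ' : IsGibbsMeasure (gibbsSpecOfSummablePotential ν Φ' β) μ')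
    {f : (V → S) → ℝ} (hfm : Measurable f) {Δ : Finset V} (hfdep : DependsOn f (↑Δ : Set V))
    {M : ℝ} (hM : ∀ σ, |f σ| ≤ M) {δ : V → ℝ}
    (hδ : DobrushinMetric.IsLipBound (fun _ _ => (1 : ℝ)) f δ) :
    |(∫ σ, f σ ∂μ) - ∫ σ, f σ ∂μ'| ≤
      |β| * E₀ / 2 / (1 - c) * ∑ y ∈ Δ, c ^ ℓ y * δ y := by
  obtain ⟨s₀, -⟩ : (Set.univ : Set S).Nonempty :=
    nonempty_of_measure_ne_zero (μ := ν) (by rw [measure_univ]; exact one_ne_zero)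
  haveI : Nonempty (V → S) := ⟨fun _ => s₀⟩
  have hE0 : ∀ x, 0 ≤ E x := fun x => (hE x).nonneg fun B => by
    split_ifs
    exacts [(abs_nonneg _).trans (he B fun _ => s₀), le_rfl]
  have hD0 : ∀ x y, 0 ≤ |β| * ∑' B : Finset V, (if x ∈ B ∧ y ∈ B then b B else 0) :=
    fun x y => mul_nonneg (abs_nonneg β) (tsum_nonneg fun B => by
      split_ifs
      exacts [hb.nonneg B, le_rfl])
  have h1c : 0 < 1 - c := sub_pos.2 hc1
  have hsuper := DobrushinMetric.superSolution_geometric (nbr := nbr) hD0 hc0 hc1 hrow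
    (b := fun x => |β| * E x / 2) (B := |β| * E₀ / 2) (fun x => by have := hE0 x; positivity)
    (fun x => by
      have := mul_le_mul_of_nonneg_left (hEE x) (abs_nonneg β)
      linarith) ℓ (fun x hx => by simp [hEℓ x hx]) hℓ
  have hd0 : ∀ y, 0 ≤ |β| * E₀ / 2 / (1 - c) * c ^ ℓ y := fun y => by positivity
  calc |(∫ σ, f σ ∂μ) - ∫ σ, f σ ∂μ'|
      ≤ ∑ y ∈ Δ, (|β| * E₀ / 2 / (1 - c) * c ^ ℓ y) * δ y :=
        abs_integral_sub_integral_le_of_potential_perturbation ν hΦ hb hΦ' hb' he β hE hnot hrange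
          hc0 hc1 hrow hμ hμ' hd0 hsuper hfm hfdep hM hδ
    _ = |β| * E₀ / 2 / (1 - c) * ∑ y ∈ Δ, c ^ ℓ y * δ y := by
        rw [Finset.mul_sum]
        refine Finset.sum_congr rfl fun y _ => ?_
        ring

end Potentials

end Literature.Probability.LatticeModels

end
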